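import Literature.AlgebraicGeometry.Frobenioids.ElementaryFrobenioid
import Mathlib.CategoryTheory.MorphismProperty.Basic
import Mathlib.Data.Nat.Prime.Defs
import HarnessLib

/-!
# Frobenioids I, Definition 1.2: types of morphisms and objects in a pre-Frobenioid
# (STEP-0 calibration fragment of the abc-iut cell)

Mochizuki, *The geometry of Frobenioids I: the general theory*, Kyushu J. Math. **62** (2008)
293–400, §1, Definition 1.2 (i)–(v) and Remark 1.2.1, kurims text pp. 21–24
[cite: MochizukiFrdI2008, Def. 1.2].

For a pre-Frobenioid structure `F : C → F_Φ` (all notions below take `F` explicitly; the standing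
hypotheses of Def. 1.2 — `Φ` divisorial, `C`, `D` connected and totally epimorphic — are recorded in
`IsPreFrobenioid F` and are only assumed where a statement needs them):

* (i) linear, isometric (isometry), metrically equivalent;
* (ii) base-isomorphism, base-FSM-morphism, base-isomorphic objects, pull-back morphism,
  base-equivalent / `Div`-equivalent, base-identity / `Div`-identity endomorphisms, the submonoids
  `O^×(A) ⊆ Aut_C(A)` and `O^▷(A) ⊆ End_C(A)`;
* (iii) pre-step, step, primary pre-step, co-angular, LB-invertible, morphism of Frobenius type,
  prime-Frobenius morphism;
* (iv) Frobenius-ample, Frobenius-trivial, `Div`-Frobenius-trivial, universally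
  `Div`-Frobenius-trivial, quasi-Frobenius-trivial, sub-quasi-Frobenius-trivial, metrically
  trivial, base-trivial, `Aut`-, `Aut^sub`- and `End`-ample, perfect, group-like, Frobenius-normalized,
  unit-trivial, isotropic objects; the object property `C^istr` and the morphism properties
  `C^lin`, `C^bs-iso`, `C^pl-bk`; isotropic hulls; Frobenius-isotropic objects;
* (v) "of …-type" = every object has the property;
* Remark 1.2.1: the four implications "follow formally from the definitions" — proved.

Deliberately NOT here: *Frobenius-compact* objects (Def. 1.2 (iv): needs the `ℚ_{>0}`-action on the
perfection of the group `O^×(C)`; ≈ 40 lines, deferred), Definition 1.3 (Frobenioids).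
No statement of the paper is strengthened.
-/

namespace Literature.AlgebraicGeometry.Frobenioids

open CategoryTheory Opposite

universe w v v' u u'

namespace PreFrobenioid

variable {D : Type u} [Category.{v} D] {Φ : Dᵒᵖ ⥤ CommMonCat.{w}}
  {C : Type u'} [Category.{v'} C] (F : C ⥤ ElemFrobenioid Φ)

/-! ### Definition 1.2 (i) -/

/-- `φ` is *linear* if `deg_Fr(φ) = 1` (FrdI Def. 1.2 (i)). [cite: MochizukiFrdI2008, Def. 1.2(i)] -/
def IsLinear {A B : C} (φ : A ⟶ B) : Prop := degFr F φ = 1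

/-- `φ` is *isometric* (an *isometry*) if `Div(φ) = 0` (FrdI Def. 1.2 (i)).
[cite: MochizukiFrdI2008, Def. 1.2(i)] -/
def IsIsometry {A B : C} (φ : A ⟶ B) : Prop := Div F φ = 1

/-- Co-objective `φ, ψ` are *metrically equivalent* if `Div(φ) = Div(ψ)` (FrdI Def. 1.2 (i)).
[cite: MochizukiFrdI2008, Def. 1.2(i)] -/
def MetricallyEquivalent {A B : C} (φ ψ : A ⟶ B) : Prop := Div F φ = Div F ψ

/-! ### Definition 1.2 (ii) -/

/-- `φ` is a *base-isomorphism* if `Base(φ)` is an isomorphism of `D` (FrdI Def. 1.2 (ii)).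
[cite: MochizukiFrdI2008, Def. 1.2(ii)] -/
def IsBaseIso {A B : C} (φ : A ⟶ B) : Prop := IsIso (Base F φ)

/-- `φ` is a *base-FSM-morphism* if `Base(φ)` is an FSM-morphism of `D` (FrdI Def. 1.2 (ii)).
[cite: MochizukiFrdI2008, Def. 1.2(ii)] -/
def IsBaseFSM {A B : C} (φ : A ⟶ B) : Prop := IsFSM (Base F φ)

/-- Objects are *base-isomorphic* if they map to isomorphic objects of `D` (FrdI Def. 1.2 (ii)).
[cite: MochizukiFrdI2008, Def. 1.2(ii)] -/
def BaseIsomorphic (A B : C) : Prop := Nonempty (baseObj F A ≅ baseObj F B)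

/-- The target of the natural transformation defining pull-back morphisms, evaluated at `X`:
`Hom_C(X, B) ×_{Hom_D(X_D, B_D)} Hom_D(X_D, A_D)` (FrdI Def. 1.2 (ii)).
[cite: MochizukiFrdI2008, Def. 1.2(ii)] -/
def PullbackHomData {A B : C} (φ : A ⟶ B) (X : C) : Type (max v v') :=
  {p : (X ⟶ B) × (baseObj F X ⟶ baseObj F A) // Base F p.1 = p.2 ≫ Base F φ}

/-- The natural map `Hom_C(X, A) → Hom_C(X, B) ×_{Hom_D(X_D,B_D)} Hom_D(X_D, A_D)`,
`γ ↦ (φ ∘ γ, Base γ)` (FrdI Def. 1.2 (ii)). [cite: MochizukiFrdI2008, Def. 1.2(ii)] -/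
def pullbackHomMap {A B : C} (φ : A ⟶ B) (X : C) (γ : X ⟶ A) : PullbackHomData F φ X :=
  ⟨(γ ≫ φ, Base F γ), base_comp F γ φ⟩

/-- `φ` is a *pull-back morphism* if `Hom_C(−, A) → Hom_C(−, B) ×_{Hom_D(−,B_D)} Hom_D(−, A_D)`
is an isomorphism of functors, i.e. bijective at every `X` (FrdI Def. 1.2 (ii)).
[cite: MochizukiFrdI2008, Def. 1.2(ii)] -/
def IsPullbackMorphism {A B : C} (φ : A ⟶ B) : Prop :=
  ∀ X : C, Function.Bijective (pullbackHomMap F φ X)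

/-- Co-objective `φ, ψ` are *base-equivalent* if `Base(φ) = Base(ψ)` (FrdI Def. 1.2 (ii)).
[cite: MochizukiFrdI2008, Def. 1.2(ii)] -/
def BaseEquivalent {A B : C} (φ ψ : A ⟶ B) : Prop := Base F φ = Base F ψ

/-- Co-objective `φ, ψ` are *`Div`-equivalent* if `Φ(φ) = Φ(ψ)`, i.e. the induced pull-back maps
`Φ(B_D) → Φ(A_D)` coincide (FrdI Def. 1.2 (ii)). [cite: MochizukiFrdI2008, Def. 1.2(ii)] -/
def DivEquivalent {A B : C} (φ ψ : A ⟶ B) : Prop := pull Φ (Base F φ) = pull Φ (Base F ψ)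

/-- A *base-identity* endomorphism: base-equivalent to the identity (FrdI Def. 1.2 (ii)).
[cite: MochizukiFrdI2008, Def. 1.2(ii)] -/
def IsBaseIdentity {A : C} (φ : A ⟶ A) : Prop := Base F φ = 𝟙 (baseObj F A)

/-- A *`Div`-identity* endomorphism: `Div`-equivalent to the identity (FrdI Def. 1.2 (ii)).
[cite: MochizukiFrdI2008, Def. 1.2(ii)] -/
def IsDivIdentity {A : C} (φ : A ⟶ A) : Prop := pull Φ (Base F φ) = MonoidHom.id _

/-- `O^▷(A) ⊆ End_C(A)`: the submonoid of base-identity linear endomorphisms (FrdI Def. 1.2 (ii);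
recall Mathlib's `End A` multiplies by `f * g = g ≫ f`). [cite: MochizukiFrdI2008, Def. 1.2(ii)] -/
def endSubmonoid (A : C) : Submonoid (End A) where
  carrier := {φ | IsBaseIdentity F φ ∧ IsLinear F φ}
  one_mem' := ⟨base_id F A, degFr_id F A⟩
  mul_mem' := by
    rintro f g ⟨hf₁, hf₂⟩ ⟨hg₁, hg₂⟩
    refine ⟨?_, ?_⟩
    · show Base F (g ≫ f) = 𝟙 _
      rw [base_comp, hg₁, hf₁, Category.id_comp]
    · show degFr F (g ≫ f) = 1
      rw [degFr_comp, hg₂, hf₂, mul_one]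

/-- `O^×(A) ⊆ Aut_C(A)`: the subgroup of base-identity linear automorphisms (FrdI Def. 1.2 (ii);
Mathlib's `Aut A` multiplies by `x * y = y ≪≫ x`). [cite: MochizukiFrdI2008, Def. 1.2(ii)] -/
def unitsSubgroup (A : C) : Subgroup (Aut A) where
  carrier := {α | IsBaseIdentity F α.hom ∧ IsLinear F α.hom}
  one_mem' := ⟨base_id F A, degFr_id F A⟩
  mul_mem' := by
    rintro f g ⟨hf₁, hf₂⟩ ⟨hg₁, hg₂⟩
    refine ⟨?_, ?_⟩
    · show Base F (g.hom ≫ f.hom) = 𝟙 _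
      rw [base_comp, hg₁, hf₁, Category.id_comp]
    · show degFr F (g.hom ≫ f.hom) = 1
      rw [degFr_comp, hg₂, hf₂, mul_one]
  inv_mem' := by
    rintro f ⟨hf₁, hf₂⟩
    have hb : Base F (f.hom ≫ f.inv) = 𝟙 _ := by rw [Iso.hom_inv_id, base_id]
    have hd : degFr F (f.hom ≫ f.inv) = 1 := by rw [Iso.hom_inv_id, degFr_id]
    rw [base_comp, hf₁, Category.id_comp] at hb
    rw [degFr_comp, hf₂, one_mul] at hd
    exact ⟨hb, hd⟩

/-! ### Definition 1.2 (iii) -/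

/-- A *pre-step*: a linear base-isomorphism (FrdI Def. 1.2 (iii)). [cite: MochizukiFrdI2008, Def. 1.2(iii)] -/
def IsPreStep {A B : C} (φ : A ⟶ B) : Prop := IsLinear F φ ∧ IsBaseIso F φ

/-- A *step*: a pre-step that is not an isomorphism (FrdI Def. 1.2 (iii)).
[cite: MochizukiFrdI2008, Def. 1.2(iii)] -/
def IsStep {A B : C} (φ : A ⟶ B) : Prop := IsPreStep F φ ∧ ¬ IsIso φ

/-- A *primary pre-step*: a pre-step whose zero divisor is a primary element of `Φ(A)`
(FrdI Def. 1.2 (iii)). [cite: MochizukiFrdI2008, Def. 1.2(iii)] -/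
def IsPrimaryPreStep {A B : C} (φ : A ⟶ B) : Prop := IsPreStep F φ ∧ IsPrimary (Div F φ)

/-- `φ` is *co-angular* if in every factorisation `φ = α ∘ β ∘ γ` with `α` linear, `β` an isometric
pre-step and `α` or `γ` a base-isomorphism, the arrow `β` is an isomorphism (FrdI Def. 1.2 (iii)).
[cite: MochizukiFrdI2008, Def. 1.2(iii)] -/
def IsCoAngular {A B : C} (φ : A ⟶ B) : Prop :=
  ∀ ⦃X Y : C⦄ (γ : A ⟶ X) (β : X ⟶ Y) (α : Y ⟶ B), γ ≫ β ≫ α = φ → IsLinear F α →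
    IsIsometry F β → IsPreStep F β → (IsBaseIso F α ∨ IsBaseIso F γ) → IsIso β

/-- `φ` is *LB-invertible* if it is co-angular and isometric (FrdI Def. 1.2 (iii)).
[cite: MochizukiFrdI2008, Def. 1.2(iii)] -/
def IsLBInvertible {A B : C} (φ : A ⟶ B) : Prop := IsCoAngular F φ ∧ IsIsometry F φ

/-- `φ` is a *morphism of Frobenius type* if it is an LB-invertible base-isomorphism
(FrdI Def. 1.2 (iii)). [cite: MochizukiFrdI2008, Def. 1.2(iii)] -/
def IsFrobeniusType {A B : C} (φ : A ⟶ B) : Prop := IsLBInvertible F φ ∧ IsBaseIso F φ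

/-- `φ` is a *prime-Frobenius morphism* if it is of Frobenius type with `deg_Fr(φ)` prime
(FrdI Def. 1.2 (iii)). [cite: MochizukiFrdI2008, Def. 1.2(iii)] -/
def IsPrimeFrobenius {A B : C} (φ : A ⟶ B) : Prop := IsFrobeniusType F φ ∧ (degFr F φ : ℕ).Prime

/-! ### Definition 1.2 (iv): types of objects -/

/-- `A` is *Frobenius-ample*: for every `n ∈ N_{≥1}` it admits an endomorphism of Frobenius degree
`n` (FrdI Def. 1.2 (iv)). [cite: MochizukiFrdI2008, Def. 1.2(iv)] -/
def IsFrobeniusAmple (A : C) : Prop := ∀ n : ℕ+, ∃ φ : A ⟶ A, degFr F φ = n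

/-- `A` is *Frobenius-trivial*: there is a homomorphism `ζ : N_{≥1} → End_C(A)` that is a section of
`deg_Fr` and whose values are base-identity endomorphisms of Frobenius type (FrdI Def. 1.2 (iv)).
[cite: MochizukiFrdI2008, Def. 1.2(iv)] -/
def IsFrobeniusTrivial (A : C) : Prop :=
  ∃ ζ : ℕ+ →* End A, ∀ n : ℕ+, degFr F (ζ n) = n ∧ IsBaseIdentity F (ζ n) ∧ IsFrobeniusType F (ζ n)

/-- `A` is *`Div`-Frobenius-trivial*: as Frobenius-trivial but with `Div`-identity endomorphisms
of Frobenius type (FrdI Def. 1.2 (iv)). [cite: MochizukiFrdI2008, Def. 1.2(iv)] -/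
def IsDivFrobeniusTrivial (A : C) : Prop :=
  ∃ ζ : ℕ+ →* End A, ∀ n : ℕ+, degFr F (ζ n) = n ∧ IsDivIdentity F (ζ n) ∧ IsFrobeniusType F (ζ n)

/-- `A` is *universally `Div`-Frobenius-trivial*: every pull-back morphism `A' → A` has
`Div`-Frobenius-trivial domain (FrdI Def. 1.2 (iv)). [cite: MochizukiFrdI2008, Def. 1.2(iv)] -/
def IsUniversallyDivFrobeniusTrivial (A : C) : Prop :=
  ∀ ⦃A' : C⦄ (ψ : A' ⟶ A), IsPullbackMorphism F ψ → IsDivFrobeniusTrivial F A'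

/-- `A` is *quasi-Frobenius-trivial*: for every `n` it admits a base-identity endomorphism of
Frobenius degree `n` (FrdI Def. 1.2 (iv)). [cite: MochizukiFrdI2008, Def. 1.2(iv)] -/
def IsQuasiFrobeniusTrivial (A : C) : Prop :=
  ∀ n : ℕ+, ∃ φ : A ⟶ A, IsBaseIdentity F φ ∧ degFr F φ = n

/-- `A` is *sub-quasi-Frobenius-trivial*: some co-angular pre-step `B → A` has quasi-Frobenius-
trivial domain (FrdI Def. 1.2 (iv)). [cite: MochizukiFrdI2008, Def. 1.2(iv)] -/
def IsSubQuasiFrobeniusTrivial (A : C) : Prop :=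
  ∃ (B : C) (ψ : B ⟶ A), IsCoAngular F ψ ∧ IsPreStep F ψ ∧ IsQuasiFrobeniusTrivial F B

/-- `A` is *metrically trivial*: every co-angular pre-step `A → B` has codomain isomorphic to `A`
(FrdI Def. 1.2 (iv)). [cite: MochizukiFrdI2008, Def. 1.2(iv)] -/
def IsMetricallyTrivial (A : C) : Prop :=
  ∀ ⦃B : C⦄ (ψ : A ⟶ B), IsCoAngular F ψ → IsPreStep F ψ → Nonempty (B ≅ A)

/-- `A` is *base-trivial*: every object base-isomorphic to `A` is isomorphic to `A`
(FrdI Def. 1.2 (iv)). [cite: MochizukiFrdI2008, Def. 1.2(iv)] -/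
def IsBaseTrivial (A : C) : Prop := ∀ B : C, BaseIsomorphic F A B → Nonempty (B ≅ A)

/-- `A` is *`Aut`-ample*: `Aut_C(A) → Aut_D(A_D)` is surjective (FrdI Def. 1.2 (iv)).
[cite: MochizukiFrdI2008, Def. 1.2(iv)] -/
def IsAutAmple (A : C) : Prop :=
  Function.Surjective fun α : Aut A => (baseFunctor F).mapIso α

/-- `A` is *`Aut^sub`-ample*: `Aut^sub_C(A) → Aut^sub_D(A_D)` is surjective (FrdI Def. 1.2 (iv)).
[cite: MochizukiFrdI2008, Def. 1.2(iv)] -/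
def IsAutSubAmple (A : C) : Prop :=
  ∀ f ∈ autSub (baseObj F A), ∃ α ∈ autSub A, Base F α = f

/-- `A` is *`End`-ample*: `End_C(A) → End_D(A_D)` is surjective (FrdI Def. 1.2 (iv)).
[cite: MochizukiFrdI2008, Def. 1.2(iv)] -/
def IsEndAmple (A : C) : Prop := ∀ f : baseObj F A ⟶ baseObj F A, ∃ α : A ⟶ A, Base F α = f

/-- `A` is *perfect*: for every `n`, every object base-isomorphic to `A` is the codomain of a
morphism of Frobenius type of degree `n`, and pre-steps descend uniquely along pairs of such
morphisms (FrdI Def. 1.2 (iv)). [cite: MochizukiFrdI2008, Def. 1.2(iv)] -/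
def IsPerfectObj (A : C) : Prop :=
  ∀ n : ℕ+,
    (∀ B : C, BaseIsomorphic F A B → ∃ (B₀ : C) (φ : B₀ ⟶ B), IsFrobeniusType F φ ∧ degFr F φ = n) ∧
    ∀ ⦃B₁ B₁' B₂ B₂' : C⦄ (φ₁ : B₁ ⟶ B₁') (φ₂ : B₂ ⟶ B₂'), BaseIsomorphic F A B₁ →
      BaseIsomorphic F A B₂ → IsFrobeniusType F φ₁ → degFr F φ₁ = n → IsFrobeniusType F φ₂ →
      degFr F φ₂ = n → ∀ ψ' : B₁' ⟶ B₂', IsPreStep F ψ' →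
        ∃! ψ : B₁ ⟶ B₂, IsPreStep F ψ ∧ ψ ≫ φ₂ = φ₁ ≫ ψ'

/-- `A` is *group-like*: `Φ(A) = 0` (FrdI Def. 1.2 (iv)). [cite: MochizukiFrdI2008, Def. 1.2(iv)] -/
def IsGroupLikeObj (A : C) : Prop := ∀ x : Φ.obj (op (baseObj F A)), x = 1

/-- `A` is *Frobenius-normalized*: for every base-identity endomorphism `φ` of Frobenius degree `d`
and every `α ∈ O^▷(A)`, `α^d ∘ φ = φ ∘ α` (FrdI Def. 1.2 (iv); in diagrammatic order
`φ ≫ α^d = α ≫ φ`). [cite: MochizukiFrdI2008, Def. 1.2(iv)] -/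
def IsFrobeniusNormalized (A : C) : Prop :=
  ∀ (φ : A ⟶ A), IsBaseIdentity F φ → ∀ α ∈ endSubmonoid F A,
    φ ≫ (show A ⟶ A from α ^ (degFr F φ : ℕ)) = (show A ⟶ A from α) ≫ φ

/-- `A` is *unit-trivial*: `O^×(A) = {1}` (FrdI Def. 1.2 (iv)). [cite: MochizukiFrdI2008, Def. 1.2(iv)] -/
def IsUnitTrivial (A : C) : Prop := ∀ α ∈ unitsSubgroup F A, α = 1

/-- `A` is *isotropic*: every isometric pre-step `A → B` is an isomorphism (FrdI Def. 1.2 (iv)).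
[cite: MochizukiFrdI2008, Def. 1.2(iv)] -/
def IsIsotropic (A : C) : Prop :=
  ∀ ⦃B : C⦄ (ψ : A ⟶ B), IsIsometry F ψ → IsPreStep F ψ → IsIso ψ

/-- `C^istr ⊆ C`, the full subcategory of isotropic objects, as an object property
(FrdI Def. 1.2 (iv)). [cite: MochizukiFrdI2008, Def. 1.2(iv)] -/
def isotropicObjects : ObjectProperty C := fun A => IsIsotropic F A

/-- `C^lin`: the class of linear morphisms (FrdI Def. 1.2 (iv)). [cite: MochizukiFrdI2008, Def. 1.2(iv)] -/
def linearMorphisms : MorphismProperty C := fun _ _ φ => IsLinear F φ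

/-- `C^bs-iso`: the class of base-isomorphisms (FrdI Def. 1.2 (iv)).
[cite: MochizukiFrdI2008, Def. 1.2(iv)] -/
def baseIsomorphisms : MorphismProperty C := fun _ _ φ => IsBaseIso F φ

/-- `C^pl-bk`: the class of pull-back morphisms (FrdI Def. 1.2 (iv)).
[cite: MochizukiFrdI2008, Def. 1.2(iv)] -/
def pullbackMorphisms : MorphismProperty C := fun _ _ φ => IsPullbackMorphism F φ

/-- `φ : A → B` is an *isotropic hull* of `A`: an isometric pre-step to an isotropic object
through which every arrow from `A` to an isotropic object factors uniquely (FrdI Def. 1.2 (iv)).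
[cite: MochizukiFrdI2008, Def. 1.2(iv)] -/
def IsIsotropicHull {A B : C} (φ : A ⟶ B) : Prop :=
  IsIsometry F φ ∧ IsPreStep F φ ∧ IsIsotropic F B ∧
    ∀ ⦃C' : C⦄ (γ : A ⟶ C'), IsIsotropic F C' → ∃! β : B ⟶ C', φ ≫ β = γ

/-- `A` is *Frobenius-isotropic*: some morphism of Frobenius type `A → B` has isotropic codomain
(FrdI Def. 1.2 (iv)). [cite: MochizukiFrdI2008, Def. 1.2(iv)] -/
def IsFrobeniusIsotropic (A : C) : Prop :=
  ∃ (B : C) (φ : A ⟶ B), IsFrobeniusType F φ ∧ IsIsotropic F B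

/-! ### Definition 1.2 (v): "of …-type" -/

/-- The pre-Frobenioid is *of `P`-type* if every object has property `P` (FrdI Def. 1.2 (v): of
Frobenius-ample, Frobenius-trivial, …, isotropic, Frobenius-isotropic type).
[cite: MochizukiFrdI2008, Def. 1.2(v)] -/
def IsOfType (P : C → Prop) : Prop := ∀ A : C, P A

/-- *Of isotropic type* (FrdI Def. 1.2 (v)). [cite: MochizukiFrdI2008, Def. 1.2(v)] -/
abbrev IsOfIsotropicType : Prop := IsOfType (IsIsotropic F)

/-- *Of perfect type* (FrdI Def. 1.2 (v)). [cite: MochizukiFrdI2008, Def. 1.2(v)] -/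
abbrev IsOfPerfectType : Prop := IsOfType (IsPerfectObj F)

/-- *Of Frobenius-trivial type* (FrdI Def. 1.2 (v)). [cite: MochizukiFrdI2008, Def. 1.2(v)] -/
abbrev IsOfFrobeniusTrivialType : Prop := IsOfType (IsFrobeniusTrivial F)

/-! ### Remark 1.2.1: formal implications -/

/-- Isomorphisms are base-isomorphisms (functors preserve isomorphisms). [cite: MochizukiFrdI2008, Rem. 1.2.1] -/
theorem isBaseIso_of_isIso {A B : C} (φ : A ⟶ B) [IsIso φ] : IsBaseIso F φ :=
  (inferInstance : IsIso ((baseFunctor F).map φ))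

/-- An isomorphism is a pull-back morphism (half of the first line of Remark 1.2.1).
[cite: MochizukiFrdI2008, Rem. 1.2.1] -/
theorem isPullbackMorphism_of_isIso {A B : C} (φ : A ⟶ B) [IsIso φ] : IsPullbackMorphism F φ := by
  intro X
  constructor
  · intro γ γ' h
    have h1 := congrArg (fun p : PullbackHomData F φ X => p.1.1) h
    exact (cancel_mono φ).mp h1
  · rintro ⟨⟨δ, ε⟩, hδ⟩
    refine ⟨δ ≫ inv φ, Subtype.ext (Prod.ext (by simp [pullbackHomMap]) ?_)⟩
    show Base F (δ ≫ inv φ) = ε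
    dsimp only at hδ
    have hφ : Base F φ ≫ Base F (inv φ) = 𝟙 _ := by rw [← base_comp, IsIso.hom_inv_id, base_id]
    rw [base_comp, hδ, Category.assoc, hφ, Category.comp_id]

/-- Remark 1.2.1, first line: "pull-back morphism which is a base-isomorphism ⟺ isomorphism".
[cite: MochizukiFrdI2008, Rem. 1.2.1] -/
theorem isPullbackMorphism_and_isBaseIso_iff_isIso {A B : C} (φ : A ⟶ B) :
    IsPullbackMorphism F φ ∧ IsBaseIso F φ ↔ IsIso φ := by
  constructor
  · rintro ⟨hpb, hbi⟩
    haveI : IsIso (Base F φ) := hbi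
    -- a section of `φ` over the inverse of `Base φ`
    obtain ⟨γ, hγ⟩ := (hpb B).2 ⟨(𝟙 B, inv (Base F φ)), by rw [base_id, IsIso.inv_hom_id]⟩
    have hγ₁ : γ ≫ φ = 𝟙 B := congrArg (fun p : PullbackHomData F φ B => p.1.1) hγ
    have hγ₂ : Base F γ = inv (Base F φ) := congrArg (fun p : PullbackHomData F φ B => p.1.2) hγ
    -- `φ ≫ γ` and `𝟙 A` have the same image under the (injective) pull-back map at `A`
    have hφγ : φ ≫ γ = 𝟙 A := by
      apply (hpb A).1
      apply Subtype.ext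
      apply Prod.ext
      · show (φ ≫ γ) ≫ φ = 𝟙 A ≫ φ
        rw [Category.assoc, hγ₁, Category.comp_id, Category.id_comp]
      · show Base F (φ ≫ γ) = Base F (𝟙 A)
        rw [base_comp, hγ₂, IsIso.hom_inv_id, base_id]
    exact ⟨⟨γ, hφγ, hγ₁⟩⟩
  · intro h
    exact ⟨isPullbackMorphism_of_isIso F φ, isBaseIso_of_isIso F φ⟩

/-- Remark 1.2.1, second line: "base-trivial ⟹ metrically trivial" (a pre-step is a
base-isomorphism). [cite: MochizukiFrdI2008, Rem. 1.2.1] -/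
theorem IsBaseTrivial.isMetricallyTrivial {A : C} (h : IsBaseTrivial F A) : IsMetricallyTrivial F A := by
  intro B ψ _ hψ
  haveI : IsIso (Base F ψ) := hψ.2
  exact h B ⟨asIso (Base F ψ)⟩

/-- Remark 1.2.1, third line: "base-identity ⟹ `Div`-identity". [cite: MochizukiFrdI2008, Rem. 1.2.1] -/
theorem IsBaseIdentity.isDivIdentity {A : C} {φ : A ⟶ A} (h : IsBaseIdentity F φ) :
    IsDivIdentity F φ := by
  unfold IsDivIdentity
  rw [h]
  ext x
  exact pull_id Φ _ x

/-- Remark 1.2.1, fourth line: "universally `Div`-Frobenius-trivial ⟹ `Div`-Frobenius-trivial"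
(the identity is a pull-back morphism). [cite: MochizukiFrdI2008, Rem. 1.2.1] -/
theorem IsUniversallyDivFrobeniusTrivial.isDivFrobeniusTrivial {A : C}
    (h : IsUniversallyDivFrobeniusTrivial F A) : IsDivFrobeniusTrivial F A :=
  h (𝟙 A) (isPullbackMorphism_of_isIso F (𝟙 A))

end PreFrobenioid

end Literature.AlgebraicGeometry.Frobenioids
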